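import Summits.FinalStateConjecture.Statement
import Literature.Geometry.Lorentzian.TameGenericity

/-! Probe (planner-cruxidea-10809-5): which genericity notion does the audited Statement use today?
If `probe_tame` elaborates, `FinalStateConjecture` unfolds to `IsTameChristodoulouGeneric … 1`
(semantic-vacuity audit re-type T2, 2026-08-16), whereas the filed crux
`BartnikGapSettling.GenericCensorshipCollarMargin` (stmt-10809) is stated with the topology-free
`IsChristodoulouGeneric … 1`. -/

open Literature.Geometry.Lorentzian
open scoped Manifold ContDiff

theorem probe_tame (h : FinalStateConjecture) (X : Type) [TopologicalSpace X] [ChartedSpace E3 X]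
    [IsManifold (𝓡 3) ∞ X] [T2Space X] [SecondCountableTopology X] [ConnectedSpace X] :
    ∃ P : InitialDataSet (𝓡 3) X → Prop,
      InitialDataSet.IsTameChristodoulouGeneric (admissibleVacuumData X) P 1 :=
  ⟨_, h X⟩

/-- Tame ⇒ topology-free is in the tree; the converse is what a `closes` from the filed crux would need. -/
example (X : Type) [TopologicalSpace X] [ChartedSpace E3 X] [IsManifold (𝓡 3) ∞ X]
    (𝓓 : Set (InitialDataSet (𝓡 3) X)) (P : InitialDataSet (𝓡 3) X → Prop)
    (h : InitialDataSet.IsTameChristodoulouGeneric 𝓓 P 1) :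
    InitialDataSet.IsChristodoulouGeneric 𝓓 P 1 :=
  h.isChristodoulouGeneric
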